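import Summits.QuantumAdvantage.QuantumAdvantage.Theorems.LinnikCubicClassGroupsDegreeOnePrimesEscapeConjInvariantPNTCongr
import Summits.QuantumAdvantage.QuantumAdvantage.Theorems.LinnikCubicClassGroupsDegreeOnePrimesEscapePermutationType
import HarnessLib

/-!
# The Chebotarev density theorem for splitting types in the Linnik range — every number field

Topic `Summits/QuantumAdvantage/QuantumAdvantage/Theorems`, cell B2b-1 (linnik-cubic), PART A (gen 14);
helper toward the crux `DegreeOnePrimesEscape` (stmt-QuantumAdvantage-11543) of route
`LinnikCubicClassGroups`.  HONEST FRAMING: the value of this file is a THEOREM (kernel-checked, GRH-free,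
Siegel-free, no hypothesis) — NOT summit progress.

**Theorem** (`splittingType_PNT`).  Let `n > 1` and `0 < ε ≤ 1`.  There are `L, c > 0` (`c ≤ 1/4`) such
that the following holds for EVERY number field `K` of degree `n`.  Let `N ⊇ f(K)` be a Galois number field
with `[N:ℚ] ≤ n!` and `|d_N| ≤ |d_K|^{[N:ℚ]}` (the Galois closure, `exists_galoisClosure_perm`) and
`ψ : G = Gal(N/ℚ) → S_n` any permutation representation with `Gal(N/f K) = Stab(0)` (the action on the
embeddings `K → N`).  Then there are `θ ∈ {0,1}`, `β₁ ∈ (1 − c/(log|d_K| + log 4), 1)` and a normal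
subgroup `K₁ ≤ G` (for `θ = 1`: `ζ_N(β₁) = 0`, `[G:K₁] = 2` and `ζ_{N^H}(β₁) = 0 ↔ H ≤ K₁`, i.e. `K₁`
cuts out the quadratic field carrying the exceptional zero; for `θ = 0`: `K₁ = G`) such that for every
`σ ∈ G`, with `T` the cycle type of `ψ σ` padded by fixed points, `S_T = {g : type of ψ g = T}`, and every
`x ≥ |d_K|^L`:

  `|#{p ≤ x : splittingType K p = T} − M_T(x)| ≤ ε M_T(x)`,
  `M_T(x) = (|S_T| Li(x) − θ (|S_T ∩ K₁| − |S_T ∖ K₁|) Li(x^{β₁})) / |G|`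

(`Li = offsetLogIntegral`; ALL primes `p ≤ x` are counted, the `≤ 2 log|d_N|` ramified ones being absorbed).
Every splitting type that occurs at an unramified prime is such a `T` (Dedekind); `|S_T|/|G|` is its
Chebotarev density and `(|S_T ∩ K₁| − |S_T ∖ K₁|)/|G| = ⟨𝟙_T, χ₁⟩` its twist by the exceptional
character.  This is [LagariasMontgomeryOdlyzko1979, Thm 1.1] / [ThornerZaman2019, Thm 1.4] read through
Dedekind's dictionary, for an arbitrary number field (gen 11 had `S_n`-fields, cubic and cyclic fields);
inexplicit `L(n, ε)`, `c(n)`.  Unconditional.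

Proof: `conjInvariant_PNT_pi_congr` in every degree `m ≤ n!` (uniform constants by summing / maximising
over `m`), the conjugation-invariant set `S_T`, and the dictionary `frobenius_mem_cycleTypeSet_iff`.
-/

noncomputable section

open scoped NumberField nonZeroDivisors
open Finset Real Ideal NumberField
open Literature.NumberTheory.NumberFields Literature.NumberTheory.LFunctions
  Literature.NumberTheory.LFunctions.NumberField

namespace Summit.QuantumAdvantage.QuantumAdvantage.Theorems.DegreeOnePrimesEscape

set_option maxHeartbeats 4000000 in
/-- **The Chebotarev density theorem for splitting types in the Linnik range, for every number field**
(see the module docstring).  Unconditional. [cite: LagariasMontgomeryOdlyzko1979, Theorem 1.1]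
[cite: ThornerZaman2019, Theorem 1.4] [cite: Perlis1977, §1] -/
theorem splittingType_PNT (n : ℕ) [NeZero n] (hn : 1 < n) {ε : ℝ} (hε : 0 < ε) (hε1 : ε ≤ 1) :
    ∃ L c : ℝ, 0 < L ∧ 0 < c ∧ c ≤ 1 / 4 ∧ ∀ (K : Type) [Field K] [NumberField K],
      Module.finrank ℚ K = n →
      ∀ (N : Type) [Field N] [NumberField N] [IsGalois ℚ N] (f : K →ₐ[ℚ] N),
        Module.finrank ℚ N ≤ n.factorial →
        (NumberField.discr N).natAbs ≤ (NumberField.discr K).natAbs ^ Module.finrank ℚ N →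
        ∀ ψ : (N ≃ₐ[ℚ] N) →* Equiv.Perm (Fin n),
          (∀ g : N ≃ₐ[ℚ] N, g ∈ f.fieldRange.fixingSubgroup ↔ ψ g 0 = 0) →
          ∃ (θ β₁ : ℝ) (K₁ : Subgroup (N ≃ₐ[ℚ] N)), (θ = 0 ∨ θ = 1) ∧ K₁.Normal ∧
            1 - c / (Real.log ((NumberField.discr K).natAbs : ℝ) + Real.log 4) < β₁ ∧ β₁ < 1 ∧
            (θ = 1 → dedekindZeta₁ N β₁ = 0 ∧ K₁.index = 2 ∧
              ∀ H : Subgroup (N ≃ₐ[ℚ] N),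
                dedekindZeta₁ (IntermediateField.fixedField H) β₁ = 0 ↔ H ≤ K₁) ∧
            (θ = 0 → K₁ = ⊤) ∧
            ∀ σ : N ≃ₐ[ℚ] N, ∀ x : ℝ, ((NumberField.discr K).natAbs : ℝ) ^ L ≤ x →
              |((((Nat.primesLE ⌊x⌋₊).filter (fun p : ℕ => splittingType K p =
                  (ψ σ).cycleType + Multiset.replicate (n - (ψ σ).support.card) 1)).card : ℕ) : ℝ) -
                ((Nat.card {g : N ≃ₐ[ℚ] N //
                    (ψ g).cycleType + Multiset.replicate (n - (ψ g).support.card) 1 =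
                      (ψ σ).cycleType + Multiset.replicate (n - (ψ σ).support.card) 1} : ℝ) *
                    offsetLogIntegral x -
                  θ * ((Nat.card {g : N ≃ₐ[ℚ] N //
                      (ψ g).cycleType + Multiset.replicate (n - (ψ g).support.card) 1 =
                        (ψ σ).cycleType + Multiset.replicate (n - (ψ σ).support.card) 1 ∧ g ∈ K₁} : ℝ) -
                    Nat.card {g : N ≃ₐ[ℚ] N //
                      (ψ g).cycleType + Multiset.replicate (n - (ψ g).support.card) 1 =
                        (ψ σ).cycleType + Multiset.replicate (n - (ψ σ).support.card) 1 ∧ g ∉ K₁}) *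
                    offsetLogIntegral (x ^ β₁)) / Nat.card (N ≃ₐ[ℚ] N)| ≤
                ε * (((Nat.card {g : N ≃ₐ[ℚ] N //
                    (ψ g).cycleType + Multiset.replicate (n - (ψ g).support.card) 1 =
                      (ψ σ).cycleType + Multiset.replicate (n - (ψ σ).support.card) 1} : ℝ) *
                    offsetLogIntegral x -
                  θ * ((Nat.card {g : N ≃ₐ[ℚ] N //
                      (ψ g).cycleType + Multiset.replicate (n - (ψ g).support.card) 1 =
                        (ψ σ).cycleType + Multiset.replicate (n - (ψ σ).support.card) 1 ∧ g ∈ K₁} : ℝ) -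
                    Nat.card {g : N ≃ₐ[ℚ] N //
                      (ψ g).cycleType + Multiset.replicate (n - (ψ g).support.card) 1 =
                        (ψ σ).cycleType + Multiset.replicate (n - (ψ σ).support.card) 1 ∧ g ∉ K₁}) *
                    offsetLogIntegral (x ^ β₁)) / Nat.card (N ≃ₐ[ℚ] N)) := by
  classical
  -- one pair of constants for every possible degree `m ≤ n!` of `N`
  have hdeg : ∀ m : ℕ, ∃ L c : ℝ, 0 < L ∧ 0 < c ∧ c ≤ 1 / 4 ∧ (1 < m →
      ∀ (N : Type) [Field N] [NumberField N] [IsGalois ℚ N], Module.finrank ℚ N = m →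
      ∃ (θ β₁ : ℝ) (K₁ : Subgroup (N ≃ₐ[ℚ] N)), (θ = 0 ∨ θ = 1) ∧ K₁.Normal ∧
        1 - c / (Real.log ((NumberField.discr N).natAbs : ℝ) + Real.log 4) < β₁ ∧ β₁ < 1 ∧
        (θ = 1 → dedekindZeta₁ N β₁ = 0 ∧ K₁.index = 2 ∧
          ∀ H : Subgroup (N ≃ₐ[ℚ] N),
            dedekindZeta₁ (IntermediateField.fixedField H) β₁ = 0 ↔ H ≤ K₁) ∧
        (θ = 0 → K₁ = ⊤ ∧ ¬ ∃ β : ℝ, dedekindZeta₁ N β = 0 ∧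
          1 - c / (Real.log ((NumberField.discr N).natAbs : ℝ) + Real.log 4) < β ∧ β < 1) ∧
        ∀ S : Set (N ≃ₐ[ℚ] N), (∀ g h : N ≃ₐ[ℚ] N, g ∈ S → h * g * h⁻¹ ∈ S) → S.Nonempty →
          ∀ (P : ℕ → Prop) [DecidablePred P],
            (∀ p : ℕ, p.Prime → ¬ ((p : ℤ) ∣ NumberField.discr N) →
              (P p ↔ ∃ (Q : Ideal (𝓞 N)) (_ : Q.IsMaximal) (_ : Q.LiesOver (span {(p : ℤ)}))
                (φ : N ≃ₐ[ℚ] N), IsArithFrobAt ℤ φ Q ∧ Q.inertia (N ≃ₐ[ℚ] N) = ⊥ ∧ φ ∈ S)) →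
            ∀ x : ℝ, ((NumberField.discr N).natAbs : ℝ) ^ L ≤ x →
              |((((Nat.primesLE ⌊x⌋₊).filter P).card : ℕ) : ℝ) -
                ((Nat.card S : ℝ) * offsetLogIntegral x -
                  θ * ((Nat.card {g : N ≃ₐ[ℚ] N // g ∈ S ∧ g ∈ K₁} : ℝ) -
                    Nat.card {g : N ≃ₐ[ℚ] N // g ∈ S ∧ g ∉ K₁}) * offsetLogIntegral (x ^ β₁)) /
                  Nat.card (N ≃ₐ[ℚ] N)| ≤
                ε * (((Nat.card S : ℝ) * offsetLogIntegral x -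
                  θ * ((Nat.card {g : N ≃ₐ[ℚ] N // g ∈ S ∧ g ∈ K₁} : ℝ) -
                    Nat.card {g : N ≃ₐ[ℚ] N // g ∈ S ∧ g ∉ K₁}) * offsetLogIntegral (x ^ β₁)) /
                  Nat.card (N ≃ₐ[ℚ] N))) := by
    intro m
    by_cases hm : 1 < m
    · obtain ⟨L, c, hL, hc, hc4, h⟩ := conjInvariant_PNT_pi_congr m hm hε hε1
      exact ⟨L, c, hL, hc, hc4, fun _ => h⟩
    · exact ⟨1, 1 / 4, one_pos, by norm_num, le_rfl, fun h => absurd h hm⟩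
  choose Lf cf hLf hcf hcf4 hthm using hdeg
  -- uniform constants: `L = n! · Σ_{m ≤ n!} L_m`, `c = max_{m ≤ n!} c_m`
  set L : ℝ := (n.factorial : ℝ) * ∑ m ∈ Finset.range (n.factorial + 1), Lf m with hL
  have hsum1 : ∀ m ≤ n.factorial, Lf m ≤ ∑ m ∈ Finset.range (n.factorial + 1), Lf m := fun m hm =>
    Finset.single_le_sum (f := Lf) (fun i _ => (hLf i).le) (Finset.mem_range.mpr (Nat.lt_succ_of_le hm))
  have hfac1 : (1 : ℝ) ≤ n.factorial := by exact_mod_cast Nat.succ_le_of_lt (Nat.factorial_pos n)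
  have hLpos : 0 < L := by
    have : 0 < ∑ m ∈ Finset.range (n.factorial + 1), Lf m :=
      lt_of_lt_of_le (hLf 0) (hsum1 0 (Nat.zero_le _))
    rw [hL]; positivity
  obtain ⟨m₀, -, hm₀⟩ := Finset.exists_max_image (Finset.range (n.factorial + 1)) cf
    ⟨0, Finset.mem_range.mpr (Nat.succ_pos _)⟩
  refine ⟨L, cf m₀, hLpos, hcf m₀, hcf4 m₀, fun K _ _ hK N _ _ _ f hNle hdN ψ hstab => ?_⟩
  set m := Module.finrank ℚ N with hm
  have hKf : Module.finrank ℚ f.fieldRange = n := by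
    rw [← hK]; exact (f.equivFieldRange.toLinearEquiv.finrank_eq).symm
  have hKN : n ≤ m := by
    rw [← hKf]
    have h2 := Module.finrank_mul_finrank ℚ f.fieldRange N
    have hpos : 0 < Module.finrank f.fieldRange N := Module.finrank_pos
    exact le_of_le_of_eq (Nat.le_mul_of_pos_right _ hpos) h2
  have hm1 : 1 < m := lt_of_lt_of_le hn hKN
  have hcm : cf m ≤ cf m₀ := hm₀ m (Finset.mem_range.mpr (Nat.lt_succ_of_le hNle))
  obtain ⟨θ, β₁, K₁, hθ, hK₁n, hβ₁c, hβ₁1, h1, h0, hS⟩ := hthm m hm1 N rfl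
  -- sizes
  set d : ℝ := ((NumberField.discr K).natAbs : ℝ) with hd
  set dN : ℝ := ((NumberField.discr N).natAbs : ℝ) with hdN'
  have hd3 : (3 : ℝ) ≤ d := three_le_natAbs_discr_real K (by rw [hK]; exact hn)
  have hd1 : (1 : ℝ) ≤ d := by linarith
  have hdisc' : NumberField.discr f.fieldRange = NumberField.discr K :=
    (NumberField.discr_eq_discr_of_algEquiv K f.equivFieldRange).symm
  have hdKN : d ≤ dN := by
    have hdvd : NumberField.discr K ∣ NumberField.discr N := hdisc' ▸ NumberField.discr_dvd_discr f.fieldRange N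
    rw [hd, hdN']
    exact_mod_cast Nat.le_of_dvd (Int.natAbs_pos.mpr (NumberField.discr_ne_zero N))
      (Int.natAbs_dvd_natAbs.mpr hdvd)
  have hℓK : 0 < Real.log d + Real.log 4 := by
    have := Real.log_pos (by linarith : (1 : ℝ) < d); have := Real.log_pos (by norm_num : (1 : ℝ) < 4)
    linarith
  -- the window in terms of `d_K` and the uniform `c`
  have hwin : 1 - cf m₀ / (Real.log d + Real.log 4) ≤ 1 - cf m / (Real.log dN + Real.log 4) := by
    have hlog : Real.log d ≤ Real.log dN := Real.log_le_log (by linarith) hdKN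
    have h2 : cf m / (Real.log dN + Real.log 4) ≤ cf m₀ / (Real.log d + Real.log 4) :=
      div_le_div₀ (hcf m₀).le hcm hℓK (by linarith)
    linarith
  -- the range in terms of `d_K` and the uniform `L`
  have hxN : ∀ x : ℝ, d ^ L ≤ x → dN ^ Lf m ≤ x := by
    intro x hx
    have hdNR : dN ≤ d ^ (m : ℝ) := by
      rw [Real.rpow_natCast, hd, hdN']; exact_mod_cast hdN
    have h3 : (m : ℝ) * Lf m ≤ L := by
      rw [hL]
      have hmf : (m : ℝ) ≤ n.factorial := by exact_mod_cast hNle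
      exact mul_le_mul hmf (hsum1 m hNle) (hLf m).le (by positivity)
    calc dN ^ Lf m ≤ (d ^ (m : ℝ)) ^ Lf m :=
          Real.rpow_le_rpow (by rw [hdN']; positivity) hdNR (hLf m).le
      _ = d ^ ((m : ℝ) * Lf m) := by rw [← Real.rpow_mul (by linarith)]
      _ ≤ d ^ L := Real.rpow_le_rpow_of_exponent_le hd1 h3
      _ ≤ x := hx
  refine ⟨θ, β₁, K₁, hθ, hK₁n, lt_of_le_of_lt hwin hβ₁c, hβ₁1, h1, fun h00 => (h0 h00).1,
    fun σ x hx => ?_⟩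
  -- the conjugation-invariant set `S_T` and the dictionary at `p ∤ d_N`
  set T : Multiset ℕ := (ψ σ).cycleType + Multiset.replicate (n - (ψ σ).support.card) 1 with hT
  have hSinv := conjInvariant_cycleTypeSet ψ T
  have hSne : ({g : N ≃ₐ[ℚ] N |
      (ψ g).cycleType + Multiset.replicate (n - (ψ g).support.card) 1 = T} : Set (N ≃ₐ[ℚ] N)).Nonempty :=
    ⟨σ, by rw [Set.mem_setOf_eq, hT]⟩
  have hP : ∀ p : ℕ, p.Prime → ¬ ((p : ℤ) ∣ NumberField.discr N) →
      (splittingType K p = T ↔ ∃ (Q : Ideal (𝓞 N)) (_ : Q.IsMaximal) (_ : Q.LiesOver (span {(p : ℤ)}))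
        (φ : N ≃ₐ[ℚ] N), IsArithFrobAt ℤ φ Q ∧ Q.inertia (N ≃ₐ[ℚ] N) = ⊥ ∧
          φ ∈ {g : N ≃ₐ[ℚ] N |
            (ψ g).cycleType + Multiset.replicate (n - (ψ g).support.card) 1 = T}) := by
    intro p hp hpN
    rw [ArithmeticallyEquivalent.of_algEquiv f.equivFieldRange p hp]
    exact (frobenius_mem_cycleTypeSet_iff f.fieldRange ψ hstab hKf T hp hpN).symm
  exact hS _ hSinv hSne (fun p : ℕ => splittingType K p = T) hP x (hxN x hx)

/-- **The splitting-type prime number theorem for every number field, existence form**: for `n > 1`,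
`0 < ε ≤ 1` there are `L, c > 0` such that every number field `K` of degree `n` admits Galois-closure data
`(N, f, ψ)` (`[N:ℚ] ≤ n!`, `|d_N| ≤ |d_K|^{[N:ℚ]}`, `Gal(N/fK) = Stab_ψ(0)`) and `θ, β₁, K₁` for which the
conclusion of `splittingType_PNT` holds.  Unconditional. [cite: LagariasMontgomeryOdlyzko1979, Theorem 1.1] -/
theorem splittingType_PNT_closure (n : ℕ) [NeZero n] (hn : 1 < n) {ε : ℝ} (hε : 0 < ε) (hε1 : ε ≤ 1) :
    ∃ L c : ℝ, 0 < L ∧ 0 < c ∧ c ≤ 1 / 4 ∧ ∀ (K : Type) [Field K] [NumberField K],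
      Module.finrank ℚ K = n →
      ∃ (N : Type) (_ : Field N) (_ : NumberField N) (_ : IsGalois ℚ N) (f : K →ₐ[ℚ] N)
        (ψ : (N ≃ₐ[ℚ] N) →* Equiv.Perm (Fin n)) (θ β₁ : ℝ) (K₁ : Subgroup (N ≃ₐ[ℚ] N)),
        Module.finrank ℚ N ≤ n.factorial ∧
        (NumberField.discr N).natAbs ≤ (NumberField.discr K).natAbs ^ Module.finrank ℚ N ∧
        (∀ g : N ≃ₐ[ℚ] N, g ∈ f.fieldRange.fixingSubgroup ↔ ψ g 0 = 0) ∧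
        (θ = 0 ∨ θ = 1) ∧ K₁.Normal ∧
        1 - c / (Real.log ((NumberField.discr K).natAbs : ℝ) + Real.log 4) < β₁ ∧ β₁ < 1 ∧
        (θ = 1 → dedekindZeta₁ N β₁ = 0 ∧ K₁.index = 2 ∧
          ∀ H : Subgroup (N ≃ₐ[ℚ] N),
            dedekindZeta₁ (IntermediateField.fixedField H) β₁ = 0 ↔ H ≤ K₁) ∧
        (θ = 0 → K₁ = ⊤) ∧
        ∀ σ : N ≃ₐ[ℚ] N, ∀ x : ℝ, ((NumberField.discr K).natAbs : ℝ) ^ L ≤ x →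
          |((((Nat.primesLE ⌊x⌋₊).filter (fun p : ℕ => splittingType K p =
              (ψ σ).cycleType + Multiset.replicate (n - (ψ σ).support.card) 1)).card : ℕ) : ℝ) -
            ((Nat.card {g : N ≃ₐ[ℚ] N //
                (ψ g).cycleType + Multiset.replicate (n - (ψ g).support.card) 1 =
                  (ψ σ).cycleType + Multiset.replicate (n - (ψ σ).support.card) 1} : ℝ) *
                offsetLogIntegral x -
              θ * ((Nat.card {g : N ≃ₐ[ℚ] N //
                  (ψ g).cycleType + Multiset.replicate (n - (ψ g).support.card) 1 =
                    (ψ σ).cycleType + Multiset.replicate (n - (ψ σ).support.card) 1 ∧ g ∈ K₁} : ℝ) -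
                Nat.card {g : N ≃ₐ[ℚ] N //
                  (ψ g).cycleType + Multiset.replicate (n - (ψ g).support.card) 1 =
                    (ψ σ).cycleType + Multiset.replicate (n - (ψ σ).support.card) 1 ∧ g ∉ K₁}) *
                offsetLogIntegral (x ^ β₁)) / Nat.card (N ≃ₐ[ℚ] N)| ≤
            ε * (((Nat.card {g : N ≃ₐ[ℚ] N //
                (ψ g).cycleType + Multiset.replicate (n - (ψ g).support.card) 1 =
                  (ψ σ).cycleType + Multiset.replicate (n - (ψ σ).support.card) 1} : ℝ) *
                offsetLogIntegral x -
              θ * ((Nat.card {g : N ≃ₐ[ℚ] N //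
                  (ψ g).cycleType + Multiset.replicate (n - (ψ g).support.card) 1 =
                    (ψ σ).cycleType + Multiset.replicate (n - (ψ σ).support.card) 1 ∧ g ∈ K₁} : ℝ) -
                Nat.card {g : N ≃ₐ[ℚ] N //
                  (ψ g).cycleType + Multiset.replicate (n - (ψ g).support.card) 1 =
                    (ψ σ).cycleType + Multiset.replicate (n - (ψ σ).support.card) 1 ∧ g ∉ K₁}) *
                offsetLogIntegral (x ^ β₁)) / Nat.card (N ≃ₐ[ℚ] N)) := by
  obtain ⟨L, c, hL, hc, hc4, h⟩ := splittingType_PNT n hn hε hε1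
  refine ⟨L, c, hL, hc, hc4, fun K _ _ hK => ?_⟩
  obtain ⟨N, _, _, hGal, hdeg, hdisc, f, ψ, hstab⟩ := exists_galoisClosure_perm n K hK
  haveI := hGal
  obtain ⟨θ, β₁, K₁, hθ, hK₁n, hβ₁c, hβ₁1, h1, h0, hmain⟩ := h K hK N f hdeg hdisc ψ hstab
  exact ⟨N, inferInstance, inferInstance, hGal, f, ψ, θ, β₁, K₁, hdeg, hdisc, hstab, hθ, hK₁n, hβ₁c,
    hβ₁1, h1, h0, hmain⟩

end Summit.QuantumAdvantage.QuantumAdvantage.Theorems.DegreeOnePrimesEscape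

end
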